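import Summits.Ventures.AbcSig.Rows.Bridge
import Summits.Ventures.AbcSig.Rows.C2aL311A0
import Summits.Ventures.AbcSig.Rows.C2aL311A0AB

/-!
# Venture AbcSig — CELL `C2aL311A0`: the census statement `Rows.C2aCellRed 311 (fun a => a = 0) ∅` from the two row theorems

HONEST FRAMING. COMPUTATION cell `pub-abcsig`; CONDITIONAL theorem; no claim on ABC or any summit. Hypotheses exactly as
in `Rows/C2aL311A0.lean` and `Rows/C2aL311A0AB.lean`: `BS04Package` (CITED), `DataComplete …` (COMPUTED level files), and the
rows' per-orbit exclusions for `famB` as universally quantified hypotheses (CITED: the census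
row's certificates). Conclusion = p1's census predicate (`Rows/Statements.lean`), all four coprime coefficient
distributions `A·B = 2^a·311^m`, reduced exponents `a < n`, `m < n` (RULING H1). GENERATED by p-lean gen/make_rows.py
(after plean/make_cell_bridges.py).
-/

namespace Summit.Ventures.AbcSig

/-- Cell `C2aL311A0`: `Rows.C2aCellRed 311 (fun a => a = 0) ∅` under the rows' hypotheses. -/
theorem cell_C2aL311A0 (M : NewformModel) (hP : M.BS04Package)
    (hD622 : M.DataComplete 622 level622Orbits)
    (hD9952 : M.DataComplete 9952 level9952Orbits)
    (hX_orbit_622_4 : ∀ n m : ℕ, n ∈ ([13] : List ℕ) → M.Excludes 622 orbit_622_4 (famB (2 ^ 0 * 311 ^ m) n (fun _ _ => True)))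
    (hX_orbit_9952_1 : ∀ n m : ℕ, n ∈ ([7, 11] : List ℕ) → M.Excludes 9952 orbit_9952_1 (famB (2 ^ 0 * 311 ^ m) n (fun _ _ => True)))
    (hX_orbit_9952_2 : ∀ n m : ℕ, n ∈ ([7, 11] : List ℕ) → M.Excludes 9952 orbit_9952_2 (famB (2 ^ 0 * 311 ^ m) n (fun _ _ => True)))
    (hX_orbit_9952_9 : ∀ n m : ℕ, n ∈ ([13] : List ℕ) → M.Excludes 9952 orbit_9952_9 (famB (2 ^ 0 * 311 ^ m) n (fun _ _ => True)))
    (hX_orbit_9952_10 : ∀ n m : ℕ, n ∈ ([13] : List ℕ) → M.Excludes 9952 orbit_9952_10 (famB (2 ^ 0 * 311 ^ m) n (fun _ _ => True))) :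
    Rows.C2aCellRed 311 (fun a => a = 0) ∅ :=
  C2aCellRed_of_rows 311 (by norm_num) (by norm_num) _ _
    (fun n hn h11 hnℓ _ a m (ha : a = 0) han hm hmn x y z h1 h2 => by
      subst ha
      exact
 row_C2aL311A0 M hP hD622 hD9952 n hn h11 hnℓ m hm hmn (hX_orbit_622_4 n m) (hX_orbit_9952_1 n m) (hX_orbit_9952_2 n m) (hX_orbit_9952_9 n m) (hX_orbit_9952_10 n m) x y z h1 h2)
    (fun n hn h11 hnℓ _ a m (ha : a = 0) han hm hmn x y z h1 h2 => by
      subst ha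
      exact
 row_C2aL311A0AB M hP hD622 hD9952 n hn h11 hnℓ m hm hmn (hX_orbit_622_4 n m) (hX_orbit_9952_1 n m) (hX_orbit_9952_2 n m) (hX_orbit_9952_9 n m) (hX_orbit_9952_10 n m) x y z h1 h2)

end Summit.Ventures.AbcSig
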